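import Summits.BirchSwinnertonDyer.BirchSwinnertonDyer.Theorems.EdixhovenFibreFiveSevenTwistDegreeStepFiveSeven
import Summits.BirchSwinnertonDyer.BirchSwinnertonDyer.Theorems.EdixhovenFibreFiveSevenTwistDegreeStepFiveSevenUnitTwist
import Summits.BirchSwinnertonDyer.BirchSwinnertonDyer.Theorems.EdixhovenFibreFiveSevenTwistDegreeStepFiveSevenAddvUnitTwist
import HarnessLib

/-!
# Route `EdixhovenFibreFiveSeven`, crux TDS57 (stmt-BirchSwinnertonDyer-22227): TDS57 BY NAME from F″ and the
# three unit-twist inputs (twisted-period decomposition ⟸ Ihara; no local `p`-torsion on the twisted class;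
# additivity of a unit twist) — the Kosters–Pannekoek sub-residue ABSORBED (`--supports`)

Cell `pub/bsd-wall` (D-0145 line `route-BirchSwinnertonDyer-EdixhovenFibreFiveSeven`), seat `bsd-line-edix-p2`
(prover). THEOREMS ONLY (no definition, no named fact, no `sorry`). Nothing is closed unconditionally and BSD is
not proved by this file.

`twistDegreeStepFiveSeven_of_kato_of_unitTwistInputs` : F″ → (L-TWIST) → (TORS-TWIST) → (ADDV-UNIT-TWIST) →
`TwistDegreeStepFiveSeven`, where (all three spelled out as hypotheses; none is a route decl or a restatement of
the crux):
* (L-TWIST) `hLT` — for `V₀/ℚ` globally minimal with `E[p]` irreducible (`p ≥ 5`), a conductor-level datum `D₀`, an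
  odd prime `q ≠ p` with `q ∤ N(V₀)`, a globally minimal model `Vχ` of `V₀ ⊗ χ_{q*}`, `s² = q*`, and every newform `g`
  of `Vχ`: `Λ(D₀.f) ⊆ s·Λ(g) + p·Λ(D₀.f)`. ⟸ Ihara's lemma (tree fact `ModularForms.ribet1984_iharaLemma`) + Atkin–Li
  newness of `f ⊗ χ`; memo `TDS57-KP-RESIDUE-MEMO-v2.md` §2 (evidence on the item). NOT in the tree.
* (TORS-TWIST) `hTT` — `E[p]` irreducible, `q*` a non-square mod `p`, a `ℚ_p`-rational `p`-torsion point somewhere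
  in the class of `V₀` ⟹ none anywhere in the class of `V₀ ⊗ χ_{q*}`. Elementary (`E[p]` vs `E[p] ⊗ χ` as
  `G_{ℚ_p}`-modules, `det ρ̄ = ω`). NOT in the tree.
* (ADDV-UNIT-TWIST) `hAT` — additive reduction at `p` survives the twist by the `p`-adic unit `q*` (Tate's
  algorithm; the tree has the square-unit case `AdditivePotMult.addv_iff_of_twist` and the multiplicative case
  `mult_quadraticTwist_of_padicValRat_eq_zero`). NOT in the tree for a non-square unit.
Proof: off the Kosters–Pannekoek sub-residue, the landed `twistDegreeStep57_of_kato_of_noTorsion`; on it, the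
auxiliary prime `q` is taken from Dirichlet's theorem (Mathlib `Nat.forall_exists_prime_gt_and_eq_mod`:
`q ≡ 13 (mod 20)` at `p = 5`, `q ≡ 5 (mod 28)` at `p = 7`, `q > N`, so `q* = q` is a non-residue mod `p` and
`q ∤ 2pN`), and the landed per-curve repair `TwistDegreeStepFiveSevenUnitTwist.exists_datum_not_dvd_c_of_kato_of_unitTwist`
(lever on the twisted class + Stevens (5.2) + (L)) gives a conductor-level datum of `V` with `p ∤ c`, whence the
step by `twistDegreeStep57_of_not_dvd_c`. So, GRANTED F″: TDS57 ⟸ three items with printed/elementary provenance.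

References: [Stevens1989] §5; [Ribet1984ICM] Thm. 4.1; [DarmonDiamondTaylor1995] Lemma 4.28, §4.5;
[Kato2004Asterisque] (8.1.3), Thm. 9.7; [KostersPannekoek2017] Thm. 1, Cor. 2; [EdixhovenManin1991] §4.
-/

set_option autoImplicit false
-- the Theorems directory repeats the summit name (sibling precedent `SignedBaseChangeAssembly.lean`)
set_option linter.dupNamespace false

noncomputable section

open scoped Classical MatrixGroups

open WeierstrassCurve NumberField Literature.NumberTheory.EllipticCurves
  Literature.NumberTheory.EllipticCurves.ModularForms
  Literature.NumberTheory.EllipticCurves.Rank1Residual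
  Literature.NumberTheory.DiophantineGeometry IsDedekindDomain Rat.HeightOneSpectrum
  Summit.BirchSwinnertonDyer.Rank1Residual Summit.BirchSwinnertonDyer.Rank1Residual.Additive
  Summit.BirchSwinnertonDyer.BirchSwinnertonDyer.Theorems
  Summit.BirchSwinnertonDyer.BirchSwinnertonDyer.Theses.EdixhovenFibreFiveSeven CongruenceSubgroup

namespace Summit.BirchSwinnertonDyer.BirchSwinnertonDyer.Theorems.TwistDegreeStepFiveSevenKP

/-! ### §1 The auxiliary prime: `q ≡ 1 (mod 4)`, `q` a non-residue mod `p ∈ {5, 7}`, `q` large -/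

/-- **Dirichlet supplies the auxiliary prime**: for `p ∈ {5, 7}` and any bound `n` there is a prime `q > n`,
`q ≠ 2`, `q ≠ p`, with `q* = (−1)^{(q−1)/2} q = q` (as `q ≡ 1 mod 4`) a NON-square modulo `p`
(`q ≡ 13 mod 20`, resp. `q ≡ 5 mod 28`). [folklore] -/
theorem exists_auxPrime {p : ℕ} (hp57 : p = 5 ∨ p = 7) (n : ℕ) :
    ∃ q : ℕ, n < q ∧ q.Prime ∧ q ≠ 2 ∧ q ≠ p ∧
      ¬ IsSquare ((((-1 : ℤ) ^ (q / 2) * q : ℤ)) : ZMod p) := by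
  rcases hp57 with rfl | rfl
  · have hu : IsUnit (((13 : ℕ) : ZMod 20)) := by
      rw [← ZMod.coe_unitOfCoprime 13 (by norm_num : Nat.Coprime 13 20)]
      exact Units.isUnit _
    obtain ⟨q, hqn, hq, hqmod⟩ := Nat.forall_exists_prime_gt_and_eq_mod hu n
    have hmod : q % 20 = 13 % 20 := (ZMod.natCast_eq_natCast_iff' q 13 20).mp hqmod
    have heven : Even (q / 2) := ⟨5 * (q / 20) + 3, by omega⟩
    have hstar : ((-1 : ℤ) ^ (q / 2) * q : ℤ) = q := by rw [heven.neg_one_pow, one_mul]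
    refine ⟨q, hqn, hq, by omega, by omega, ?_⟩
    rw [hstar, Int.cast_natCast, (ZMod.natCast_eq_natCast_iff' q 3 5).mpr (by omega)]
    decide
  · have hu : IsUnit (((5 : ℕ) : ZMod 28)) := by
      rw [← ZMod.coe_unitOfCoprime 5 (by norm_num : Nat.Coprime 5 28)]
      exact Units.isUnit _
    obtain ⟨q, hqn, hq, hqmod⟩ := Nat.forall_exists_prime_gt_and_eq_mod hu n
    have hmod : q % 28 = 5 % 28 := (ZMod.natCast_eq_natCast_iff' q 5 28).mp hqmod
    have heven : Even (q / 2) := ⟨7 * (q / 28) + 1, by omega⟩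
    have hstar : ((-1 : ℤ) ^ (q / 2) * q : ℤ) = q := by rw [heven.neg_one_pow, one_mul]
    refine ⟨q, hqn, hq, by omega, by omega, ?_⟩
    rw [hstar, Int.cast_natCast, (ZMod.natCast_eq_natCast_iff' q 5 7).mpr (by omega)]
    decide

/-! ### §2 TDS57 BY NAME from F″ and the three unit-twist inputs -/

/-- **TDS57 `TwistDegreeStepFiveSeven` (stmt-BirchSwinnertonDyer-22227) GRANTED F″ and the three unit-twist
inputs** (L-TWIST) `hLT`, (TORS-TWIST) `hTT`, (ADDV-UNIT-TWIST) `hAT` (module docstring). Off the Kosters–Pannekoek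
sub-residue: the tame-twist lever (`twistDegreeStep57_of_kato_of_noTorsion`). On it: the optimal member `V₀ ∼ V`
(`X12.exists_isIsogenous_optimal`), Dirichlet's auxiliary prime `q` (§1), a globally minimal model of
`V₀ ⊗ χ_{q*}` (`exists_minimal_twist_pStar`), a square root `s` of `q*` in `ℂ`, and the landed repair
`TwistDegreeStepFiveSevenUnitTwist.exists_datum_not_dvd_c_of_kato_of_unitTwist` (lever on the twisted class +
Stevens (5.2) + (L)); then `twistDegreeStep57_of_not_dvd_c`. CONDITIONAL (F″ cite-only; the three inputs are
not in the tree); BSD is not proved by this. [cite: Stevens1989, Lemma (5.2) p. 96] [cite: Ribet1984ICM, Thm. 4.1]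
[cite: Kato2004Asterisque, (8.1.3) (p. 180), Thm. 9.7 (p. 189)] [cite: KostersPannekoek2017, Thm. 1 and Cor. 2] -/
theorem twistDegreeStepFiveSeven_of_kato_of_unitTwistInputs
    (hF : kato_neron_isIntegral_twistedSymbolSum_of_additive_five_le)
    (hLT : ∀ (p : ℕ) [Fact p.Prime] (q : ℕ) [Fact q.Prime] (V₀ : WeierstrassCurve ℚ) [V₀.IsElliptic]
      [V₀.IsGloballyMinimal] [NeZero (V₀.conductorNorm ℤ)]
      (D₀ : ModularParametrizationData V₀ (V₀.conductorNorm ℤ)), 5 ≤ p → Irr V₀ p → q ≠ 2 → q ≠ p →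
      ¬ q ∣ V₀.conductorNorm ℤ →
      ∀ (Vχ : WeierstrassCurve ℚ) [Vχ.IsElliptic] [Vχ.IsGloballyMinimal] (v : VariableChange ℚ),
      v • V₀.quadraticTwist (((-1 : ℤ) ^ (q / 2) * q : ℤ) : ℚ) = Vχ →
      ∀ (s : ℂ), s ^ 2 = (((-1 : ℤ) ^ (q / 2) * q : ℤ) : ℂ) →
      ∀ (N' : ℕ) [NeZero N'] (g : CuspForm (Gamma0 N') 2), IsNewformOf Vχ g →
      ∀ z ∈ periodLattice D₀.f, ∃ w ∈ periodLattice g, ∃ y ∈ periodLattice D₀.f, z = s * w + (p : ℂ) * y)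
    (hTT : ∀ (p : ℕ) [Fact p.Prime] (q : ℕ) [Fact q.Prime] (V₀ : WeierstrassCurve ℚ) [V₀.IsElliptic]
      [V₀.IsGloballyMinimal], 5 ≤ p → Irr V₀ p → q ≠ p →
      ¬ IsSquare ((((-1 : ℤ) ^ (q / 2) * q : ℤ)) : ZMod p) →
      (∃ (W' : WeierstrassCurve ℚ) (_ : W'.IsElliptic) (_ : W'.IsGloballyMinimal)
        (P : (W'.baseChange ℚ_[p]).toAffine.Point), IsIsogenous V₀ W' ∧ P ≠ 0 ∧ p • P = 0) →
      ∀ (Vχ : WeierstrassCurve ℚ) [Vχ.IsElliptic] [Vχ.IsGloballyMinimal] (v : VariableChange ℚ),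
      v • V₀.quadraticTwist (((-1 : ℤ) ^ (q / 2) * q : ℤ) : ℚ) = Vχ →
      ∀ (W'' : WeierstrassCurve ℚ) [W''.IsElliptic] [W''.IsGloballyMinimal], IsIsogenous Vχ W'' →
      ∀ Q : (W''.baseChange ℚ_[p]).toAffine.Point, p • Q = 0 → Q = 0)
    (hAT : ∀ (p : ℕ) [Fact p.Prime] (q : ℕ) [Fact q.Prime] (V₀ : WeierstrassCurve ℚ) [V₀.IsElliptic]
      [V₀.IsGloballyMinimal], q ≠ p → Addv V₀ p →
      ∀ (Vχ : WeierstrassCurve ℚ) [Vχ.IsElliptic] [Vχ.IsGloballyMinimal] (v : VariableChange ℚ),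
      v • V₀.quadraticTwist (((-1 : ℤ) ^ (q / 2) * q : ℤ) : ℚ) = Vχ → Addv Vχ p) :
    TwistDegreeStepFiveSeven := by
  intro hnf p hp V _ _ _ Wf _ _ _ C hp57 hadd hirr hK hV4 hC
  have hp5 : 5 ≤ p := by omega
  by_cases hPT : ∀ (W' : WeierstrassCurve ℚ) [W'.IsElliptic] [W'.IsGloballyMinimal], IsIsogenous V W' →
      ∀ P : (W'.baseChange ℚ_[p]).toAffine.Point, p • P = 0 → P = 0
  · exact TwistDegreeStepFiveSeven.twistDegreeStep57_of_kato_of_noTorsion hF hnf V Wf C hp57 hadd hirr hK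
      hV4 hC hPT
  push Not at hPT
  obtain ⟨W', hE', hM', hisoW', P, hP, hP0⟩ := hPT
  -- the optimal member of the class of `V`
  obtain ⟨V₀, hE₀, hM₀, hNz₀, D₀, hiso, -, hopt₀⟩ := X12.exists_isIsogenous_optimal hnf V
  haveI := hE₀
  haveI := hM₀
  haveI := hNz₀
  have hirr₀ : Irr V₀ p := (X12.irr_iff_of_isIsogenous hiso p).mp hirr
  have hadd₀ : Addv V₀ p := (X2.addv_iff_of_isIsogenous (p := p) hiso).mp hadd
  have hisoVW : IsIsogenous V₀ W' := (hiso.symm_of_charZero).trans' hisoW'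
  -- the auxiliary prime
  obtain ⟨q, hqN, hq, hq2, hqp, hnsq⟩ := exists_auxPrime hp57 (V₀.conductorNorm ℤ)
  haveI : Fact q.Prime := ⟨hq⟩
  have hqN' : ¬ q ∣ V₀.conductorNorm ℤ := fun h ↦
    absurd (Nat.le_of_dvd (Nat.pos_of_ne_zero (NeZero.ne _)) h) (by omega)
  have hqsq : ¬ q ^ 2 ∣ V₀.conductorNorm ℤ := fun h ↦ hqN' ((dvd_pow_self q two_ne_zero).trans h)
  have hgm : V₀.HasGoodReductionAtPrime q ∨ V₀.HasMultiplicativeReductionAtPrime q :=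
    hasGoodReductionAtPrime_or_hasMultiplicativeReductionAtPrime_of_not_sq_dvd_conductorNorm (V := V₀) hqsq
  -- a globally minimal model of the twist, and a square root of `q*`
  obtain ⟨Vχ, hEχ, hMχ, v, hv⟩ := exists_minimal_twist_pStar q V₀
  haveI := hEχ
  haveI := hMχ
  haveI : NeZero (Vχ.conductorNorm ℤ) := ⟨(Vχ.conductorNorm_pos_holds).ne'⟩
  have hv' : v • V₀.quadraticTwist (((-1 : ℤ) ^ (q / 2) * q : ℤ) : ℚ) = Vχ := by
    rw [(pStar_intCast q).1]; exact hv
  obtain ⟨s, hs2⟩ := IsAlgClosed.exists_pow_nat_eq ((((-1 : ℤ) ^ (q / 2) * q : ℤ)) : ℂ) two_pos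
  -- the three inputs at `(p, q, V₀, Vχ)`
  have haddχ : Addv Vχ p := hAT p q V₀ hqp hadd₀ Vχ v hv'
  have hPTχ := hTT p q V₀ hp5 hirr₀ hqp hnsq ⟨W', hE', hM', P, hisoVW, hP0, hP⟩ Vχ v hv'
  have hL := hLT p q V₀ D₀ hp5 hirr₀ hq2 hqp hqN' Vχ v hv' s hs2
  -- the repair and the step
  obtain ⟨D, hc⟩ :=
    TwistDegreeStepFiveSevenUnitTwist.exists_datum_not_dvd_c_of_kato_of_unitTwist hF hnf hp57 V hirr V₀ hiso D₀
      hopt₀ hq2 hgm Vχ v hv' haddχ hPTχ s hs2 hL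
  exact ⟨D, TwistDegreeStepFiveSeven.twistDegreeStep57_of_not_dvd_c hp5 V Wf hadd hK hV4 C hC D hc⟩

/-! ### §3 (appended) ADDV-UNIT-TWIST discharged: TDS57 BY NAME from F″, L-TWIST and TORS-TWIST -/

/-- **TDS57 `TwistDegreeStepFiveSeven` (stmt-BirchSwinnertonDyer-22227) GRANTED F″ and the TWO remaining
unit-twist inputs** (L-TWIST) `hLT` (⟸ Ihara's lemma) and (TORS-TWIST) `hTT` (elementary Galois): the third
input of `twistDegreeStepFiveSeven_of_kato_of_unitTwistInputs` — additivity of the unit twist — is the landed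
theorem `AddvUnitTwist.addv_of_model_twist_auxPrime` at the odd primes `p ∈ {5, 7}` of the item (same proof,
with that call in place of `hAT`). CONDITIONAL (F″ cite-only; L-TWIST, TORS-TWIST not in the tree); BSD is not
proved by this. [cite: Stevens1989, Lemma (5.2) p. 96] [cite: Ribet1984ICM, Thm. 4.1]
[cite: Kato2004Asterisque, (8.1.3) (p. 180), Thm. 9.7 (p. 189)] [cite: SilvermanAEC2009, VII.5 Prop. 5.1] -/
theorem twistDegreeStepFiveSeven_of_kato_of_twistInputs
    (hF : kato_neron_isIntegral_twistedSymbolSum_of_additive_five_le)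
    (hLT : ∀ (p : ℕ) [Fact p.Prime] (q : ℕ) [Fact q.Prime] (V₀ : WeierstrassCurve ℚ) [V₀.IsElliptic]
      [V₀.IsGloballyMinimal] [NeZero (V₀.conductorNorm ℤ)]
      (D₀ : ModularParametrizationData V₀ (V₀.conductorNorm ℤ)), 5 ≤ p → Irr V₀ p → q ≠ 2 → q ≠ p →
      ¬ q ∣ V₀.conductorNorm ℤ →
      ∀ (Vχ : WeierstrassCurve ℚ) [Vχ.IsElliptic] [Vχ.IsGloballyMinimal] (v : VariableChange ℚ),
      v • V₀.quadraticTwist (((-1 : ℤ) ^ (q / 2) * q : ℤ) : ℚ) = Vχ →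
      ∀ (s : ℂ), s ^ 2 = (((-1 : ℤ) ^ (q / 2) * q : ℤ) : ℂ) →
      ∀ (N' : ℕ) [NeZero N'] (g : CuspForm (Gamma0 N') 2), IsNewformOf Vχ g →
      ∀ z ∈ periodLattice D₀.f, ∃ w ∈ periodLattice g, ∃ y ∈ periodLattice D₀.f, z = s * w + (p : ℂ) * y)
    (hTT : ∀ (p : ℕ) [Fact p.Prime] (q : ℕ) [Fact q.Prime] (V₀ : WeierstrassCurve ℚ) [V₀.IsElliptic]
      [V₀.IsGloballyMinimal], 5 ≤ p → Irr V₀ p → q ≠ p →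
      ¬ IsSquare ((((-1 : ℤ) ^ (q / 2) * q : ℤ)) : ZMod p) →
      (∃ (W' : WeierstrassCurve ℚ) (_ : W'.IsElliptic) (_ : W'.IsGloballyMinimal)
        (P : (W'.baseChange ℚ_[p]).toAffine.Point), IsIsogenous V₀ W' ∧ P ≠ 0 ∧ p • P = 0) →
      ∀ (Vχ : WeierstrassCurve ℚ) [Vχ.IsElliptic] [Vχ.IsGloballyMinimal] (v : VariableChange ℚ),
      v • V₀.quadraticTwist (((-1 : ℤ) ^ (q / 2) * q : ℤ) : ℚ) = Vχ →
      ∀ (W'' : WeierstrassCurve ℚ) [W''.IsElliptic] [W''.IsGloballyMinimal], IsIsogenous Vχ W'' →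
      ∀ Q : (W''.baseChange ℚ_[p]).toAffine.Point, p • Q = 0 → Q = 0) :
    TwistDegreeStepFiveSeven := by
  intro hnf p hp V _ _ _ Wf _ _ _ C hp57 hadd hirr hK hV4 hC
  have hp5 : 5 ≤ p := by omega
  by_cases hPT : ∀ (W' : WeierstrassCurve ℚ) [W'.IsElliptic] [W'.IsGloballyMinimal], IsIsogenous V W' →
      ∀ P : (W'.baseChange ℚ_[p]).toAffine.Point, p • P = 0 → P = 0
  · exact TwistDegreeStepFiveSeven.twistDegreeStep57_of_kato_of_noTorsion hF hnf V Wf C hp57 hadd hirr hK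
      hV4 hC hPT
  push Not at hPT
  obtain ⟨W', hE', hM', hisoW', P, hP, hP0⟩ := hPT
  obtain ⟨V₀, hE₀, hM₀, hNz₀, D₀, hiso, -, hopt₀⟩ := X12.exists_isIsogenous_optimal hnf V
  haveI := hE₀
  haveI := hM₀
  haveI := hNz₀
  have hirr₀ : Irr V₀ p := (X12.irr_iff_of_isIsogenous hiso p).mp hirr
  have hadd₀ : Addv V₀ p := (X2.addv_iff_of_isIsogenous (p := p) hiso).mp hadd
  have hisoVW : IsIsogenous V₀ W' := (hiso.symm_of_charZero).trans' hisoW'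
  obtain ⟨q, hqN, hq, hq2, hqp, hnsq⟩ := exists_auxPrime hp57 (V₀.conductorNorm ℤ)
  haveI : Fact q.Prime := ⟨hq⟩
  have hqN' : ¬ q ∣ V₀.conductorNorm ℤ := fun h ↦
    absurd (Nat.le_of_dvd (Nat.pos_of_ne_zero (NeZero.ne _)) h) (by omega)
  have hqsq : ¬ q ^ 2 ∣ V₀.conductorNorm ℤ := fun h ↦ hqN' ((dvd_pow_self q two_ne_zero).trans h)
  have hgm : V₀.HasGoodReductionAtPrime q ∨ V₀.HasMultiplicativeReductionAtPrime q :=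
    hasGoodReductionAtPrime_or_hasMultiplicativeReductionAtPrime_of_not_sq_dvd_conductorNorm (V := V₀) hqsq
  obtain ⟨Vχ, hEχ, hMχ, v, hv⟩ := exists_minimal_twist_pStar q V₀
  haveI := hEχ
  haveI := hMχ
  haveI : NeZero (Vχ.conductorNorm ℤ) := ⟨(Vχ.conductorNorm_pos_holds).ne'⟩
  have hv' : v • V₀.quadraticTwist (((-1 : ℤ) ^ (q / 2) * q : ℤ) : ℚ) = Vχ := by
    rw [(pStar_intCast q).1]; exact hv
  obtain ⟨s, hs2⟩ := IsAlgClosed.exists_pow_nat_eq ((((-1 : ℤ) ^ (q / 2) * q : ℤ)) : ℂ) two_pos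
  -- ADDV-UNIT-TWIST is a theorem at odd `p`
  have haddχ : Addv Vχ p := AddvUnitTwist.addv_of_model_twist_auxPrime (by omega) hq hqp hadd₀ ⟨v, hv'⟩
  have hPTχ := hTT p q V₀ hp5 hirr₀ hqp hnsq ⟨W', hE', hM', P, hisoVW, hP0, hP⟩ Vχ v hv'
  have hL := hLT p q V₀ D₀ hp5 hirr₀ hq2 hqp hqN' Vχ v hv' s hs2
  obtain ⟨D, hc⟩ :=
    TwistDegreeStepFiveSevenUnitTwist.exists_datum_not_dvd_c_of_kato_of_unitTwist hF hnf hp57 V hirr V₀ hiso D₀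
      hopt₀ hq2 hgm Vχ v hv' haddχ hPTχ s hs2 hL
  exact ⟨D, TwistDegreeStepFiveSeven.twistDegreeStep57_of_not_dvd_c hp5 V Wf hadd hK hV4 C hC D hc⟩

end Summit.BirchSwinnertonDyer.BirchSwinnertonDyer.Theorems.TwistDegreeStepFiveSevenKP

end
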